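import Summits.QuantumFields.GaugeBoot.ClassBLinkCutWordBlocks
import Summits.QuantumFields.GaugeBoot.ClassBLimitCovariantLinkRP
import HarnessLib

/-!
# Cut-loop `R_link` word blocks of torus limit points; a decidable half-word criterion
(gauge-boot, Class-B brick)

HONEST FRAMING (cell `pub-gaugeboot`, page 1 of every file): the venture produces certified bounds
on lattice expectations at stated coupling, gauge group, dimension and torus size; NOT a mass gap,
NOT a continuum limit, NOT a string tension; NOT Yang–Mills-summit-bearing (barriers
`FixedCouplingUltralocality`, `PerturbativeInvisibility`). Structural bookkeeping (which SDP blocks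
are exact for infinite-volume torus limit points); certifies no number.

## Content

`ClassBLinkCutWordBlocks.lean` proved Kazakov–Zheng's link-type (cut-loop) `R_link` word blocks
for every state with the covariant link-RP property `IsCovariantLinkRP i μ`
(`ZdCovariantLinkRP.lean`), and `ClassBLimitCovariantLinkRP.lean` proved that property for every
infinite-volume limit point of the torus Wilson states in every axis (`β ≥ 0`). This module puts
the two together and supplies the `decide`-able half-word criterion (the `ℤ^d` analogue of
lean1's torus-side `Word.linkHalfOK`):

* `Word.zdLinkHalfOK i w y` (Boolean): read from the integer site `y`, every link traversed by `w`
  has its source in `{x_i ≥ 1}` (the condition of `linkHalfEdges i`);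
  `dependsOn_wordHolonomyZd_of_zdLinkHalfOK` — soundness; `Word.zdLinkHalfOK_halfPlaquette`
  (`[+e_k]` at `p + e_i`), `Word.zdLinkHalfOK_halfRectangle` (`[+e_i, +e_k, -e_i]` at `p + e_i`:
  the half of the link-symmetric `3 × 1` rectangle);
* `rLinkCutWordBlock_nonneg_of_zdLinkHalfOK` — the block theorem of `ClassBLinkCutWordBlocks.lean`
  with the Boolean hypothesis;
* ★★★ **`rLinkCutWordBlock_nonneg_of_mem_infiniteVolumeLimitPoints`** (and the trace form
  `sum_conj_mul_integral_trace_linkCutGlue_nonneg_of_mem_infiniteVolumeLimitPoints`, every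
  continuous `τ`): for `β ≥ 0`, continuous `ρ`, every infinite-volume torus limit point `μ`, every
  axis `i`, sites `p, q` with `p_i = q_i = 0`, half-words `O_a : p + e_i → q + e_i` with
  `zdLinkHalfOK`, real `c`: `0 ≤ Σ_{ab} c_a c_b ∫ W_p([+e_i] · O_b · [-e_i] · (flip_i O_a)⁻¹) dμ`;
* the `1 × 1` block of `O = [+e_k]` is the plaquette: `integral_wordLoopZd_plaquette_nonneg_of_isCovariantLinkRP`,
  `integral_wordLoopZd_plaquette_nonneg_of_mem_infiniteVolumeLimitPoints` — `0 ≤ ∫ W_p(P_{ik}) dμ`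
  at a site of the layer `x_i = 0` (for limit points in EVERY dimension, where the diagonal-RP route
  of `CutLoopCharacterPositivity.lean` is not available).

What this does NOT say: nothing about a general `ClassBState` (its `linkRP` axiom is the plain
form); no inhabitation claim; no number. [folklore] mechanism (Osterwalder–Seiler 1978 §2;
Kazakov–Zheng arXiv:2203.11360 §3.1 for the indexing by cut loops).
-/

open MeasureTheory Complex Finset Function
open scoped ComplexOrder ComplexConjugate

namespace Summit.QuantumFields.GaugeBoot

open Literature.MathematicalPhysics.QuantumLattice
open Literature.RepresentationTheory.CompactGroups

noncomputable section

/-! ## The criterion (integer geometry, decidable) -/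

namespace Word

variable {d : ℕ}

/-- Read from the integer site `y`, every link traversed by `w` has its source in the closed half
`{x_i ≥ 1}` of the link mirror `x_i = ½` (the condition of `linkHalfEdges i`). -/
def zdLinkHalfOK (i : Fin d) : Word d → (Fin d → ℤ) → Bool
  | [], _ => true
  | s :: w, y => decide (1 ≤ (s.edgeZd y).1 i) && zdLinkHalfOK i w (s.applyZd y)

/-- Unfolding on a non-empty word. -/
theorem zdLinkHalfOK_cons {i : Fin d} {s : Step d} {w : Word d} {y : Fin d → ℤ}
    (h : zdLinkHalfOK i (s :: w) y = true) :
    s.edgeZd y ∈ linkHalfEdges i ∧ zdLinkHalfOK i w (s.applyZd y) = true := by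
  simp only [zdLinkHalfOK, Bool.and_eq_true, decide_eq_true_eq] at h
  exact ⟨h.1, h.2⟩

/-- **The half plaquette qualifies**: the one-step word `[+e_k]` read from a site `y` of the layer
`x_i = 1` lies in `{x_i ≥ 1}` (its cut-glued loop is the plaquette in the `(i, k)` plane). -/
theorem zdLinkHalfOK_halfPlaquette {i : Fin d} (k : Fin d) {y : Fin d → ℤ} (hy : y i = 1) :
    zdLinkHalfOK i [Step.fwd k] y = true := by
  simp [zdLinkHalfOK, Step.edgeZd, hy]

/-- The three-link word `[+e_i, +e_k, -e_i]` read from a site `y` of the layer `x_i = 1` (`k ≠ i`)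
lies in `{x_i ≥ 1}` (its cut-glued loop is the link-symmetric `3 × 1` rectangle `[-1, 2] × [0, 1]`
in the `(i, k)` plane). -/
theorem zdLinkHalfOK_halfRectangle {i k : Fin d} (hki : k ≠ i) {y : Fin d → ℤ} (hy : y i = 1) :
    zdLinkHalfOK i [Step.fwd i, Step.fwd k, Step.bwd i] y = true := by
  simp [zdLinkHalfOK, Step.edgeZd, Step.applyZd, hy, hki]

end Word

/-! ## Soundness -/

section Sound

variable {d : ℕ} {G : Type*} [Group G]

/-- **Support bookkeeping (link half)**: a `zdLinkHalfOK` word's holonomy depends only on the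
links of the closed half `linkHalfEdges i`. -/
theorem dependsOn_wordHolonomyZd_of_zdLinkHalfOK {i : Fin d} :
    ∀ (w : Word d) (y : Fin d → ℤ), Word.zdLinkHalfOK i w y = true →
      DependsOn (fun U : LGConfig d G => wordHolonomyZd U y w) (linkHalfEdges i)
  | [], y, _ => fun U V _ => by simp
  | s :: w, y, h => fun U V hUV => by
    obtain ⟨hs, hw⟩ := Word.zdLinkHalfOK_cons h
    have ih : wordHolonomyZd U (s.applyZd y) w = wordHolonomyZd V (s.applyZd y) w :=
      dependsOn_wordHolonomyZd_of_zdLinkHalfOK w (s.applyZd y) hw hUV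
    simp only [wordHolonomyZd_cons, stepHolonomyZd_congr y s (hUV _ hs), ih]

end Sound

/-! ## The blocks with the Boolean hypothesis; the plaquette -/

section Blocks

variable {d N M : ℕ} {G : Type*} [Group G] [TopologicalSpace G] [IsTopologicalGroup G]
  [CompactSpace G] [MeasurableSpace G] [BorelSpace G] (ρ : G →* Matrix (Fin N) (Fin N) ℂ)
  (τ : G →* Matrix (Fin M) (Fin M) ℂ)

/-- ★★★ **Cut-loop `R_link` blocks with loop-variable entries, decidable hypotheses.** For a
probability measure `μ` with `IsCovariantLinkRP i μ`, continuous `ρ`, sites `p, q` of the layer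
`x_i = 0`, words `O_a : p + e_i → q + e_i` with `Word.zdLinkHalfOK i (O a) (p + e_i)` and real
`c`: `0 ≤ Σ_{ab} c_a c_b ∫ W_p([+e_i] · O_b · [-e_i] · (flip_i O_a)⁻¹) dμ`. -/
theorem rLinkCutWordBlock_nonneg_of_zdLinkHalfOK (hρ : Continuous ρ) {μ : Measure (LGConfig d G)}
    [IsProbabilityMeasure μ] {i : Fin d} (hμ : IsCovariantLinkRP i μ) {p q : Fin d → ℤ}
    (hp : p i = 0) (hq : q i = 0) {n : ℕ} (O : Fin n → Word d)
    (hend : ∀ a, Word.endpointZd (p + Pi.single i 1) (O a) = q + Pi.single i 1)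
    (hhalf : ∀ a, Word.zdLinkHalfOK i (O a) (p + Pi.single i 1) = true) (c : Fin n → ℝ) :
    0 ≤ ∑ a, ∑ b, c a * c b * ∫ U, wordLoopZd ρ p
      (Step.fwd i :: (O b ++ Step.bwd i :: Word.reverse ((O a).map (Step.flipAt i)))) U ∂μ :=
  rLinkCutWordBlock_nonneg ρ hρ hμ hp hq O hend
    (fun a => dependsOn_wordHolonomyZd_of_zdLinkHalfOK (O a) _ (hhalf a)) c

omit [MeasurableSpace G] [BorelSpace G] [TopologicalSpace G] [IsTopologicalGroup G]
  [CompactSpace G] [Group G] in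
/-- The cut-glued loop of the half plaquette `[+e_k]` (`k ≠ i`) is the plaquette word
`[+e_i, +e_k, -e_i, -e_k]`. -/
theorem linkCutGlue_halfPlaquette {i k : Fin d} (hk : k ≠ i) :
    (Step.fwd i :: ([Step.fwd k] ++ Step.bwd i ::
      Word.reverse (([Step.fwd k] : Word d).map (Step.flipAt i)))) = Word.plaquette i k := by
  simp [Word.reverse, Word.plaquette, Step.flipAt_fwd_of_ne hk]

/-- ★ **The `1 × 1` cut-loop block is the plaquette**: for a probability measure with
`IsCovariantLinkRP i μ` and continuous `ρ`, `0 ≤ ∫ W_p(P_{ik}) dμ` at every site `p` of the layer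
`x_i = 0` (`W = (1/N) Re tr ρ`, `k ≠ i`). -/
theorem integral_wordLoopZd_plaquette_nonneg_of_isCovariantLinkRP (hρ : Continuous ρ)
    {μ : Measure (LGConfig d G)} [IsProbabilityMeasure μ] {i : Fin d} (hμ : IsCovariantLinkRP i μ)
    {p : Fin d → ℤ} (hp : p i = 0) {k : Fin d} (hk : k ≠ i) :
    0 ≤ ∫ U, wordLoopZd ρ p (Word.plaquette i k) U ∂μ := by
  have hq : (p + Pi.single k 1 : Fin d → ℤ) i = 0 := by
    simp [Pi.single_eq_of_ne (Ne.symm hk), hp]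
  have hend : ∀ a : Fin 1, Word.endpointZd (p + Pi.single i 1) ((fun _ => [Step.fwd k]) a) =
      (p + Pi.single k 1) + Pi.single i 1 := fun _ => by
    simp only [Word.endpointZd_cons, Word.endpointZd_nil, Step.applyZd_fwd]
    abel
  have hhalf : ∀ a : Fin 1, Word.zdLinkHalfOK i ((fun _ => [Step.fwd k]) a) (p + Pi.single i 1) = true :=
    fun _ => Word.zdLinkHalfOK_halfPlaquette k (by simp [hp])
  have h := rLinkCutWordBlock_nonneg_of_zdLinkHalfOK ρ hρ hμ hp hq (fun _ : Fin 1 => [Step.fwd k])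
    hend hhalf (fun _ => 1)
  rw [Fin.sum_univ_one, Fin.sum_univ_one, one_mul, one_mul, linkCutGlue_halfPlaquette hk] at h
  exact h

end Blocks

/-! ## Torus limit points -/

section LimitPoints

variable {d N M : ℕ} {G : Type*} [Group G] [TopologicalSpace G] [IsTopologicalGroup G]
  [CompactSpace G] [MeasurableSpace G] [BorelSpace G] [NeZero d] [SecondCountableTopology G]
  [T2Space G] (ρ : G →* Matrix (Fin N) (Fin N) ℂ) (τ : G →* Matrix (Fin M) (Fin M) ℂ)

/-- ★★★ **Cut-loop `R_link` blocks of torus limit points — glued-loop trace entries, every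
representation.** For `β ≥ 0`, continuous `ρ`, every infinite-volume limit point `μ` of the torus
Wilson states, every axis `i`, sites `p, q` with `p_i = q_i = 0`, half-words `O_a : p + e_i → q + e_i`
(holonomies supported in `linkHalfEdges i`), continuous `τ` and `c ∈ ℂ^n`:
`0 ≤ Σ_{ab} c̄_a c_b ∫ tr τ(hol_p([+e_i] · O_b · [-e_i] · (flip_i O_a)⁻¹)) dμ`. -/
theorem sum_conj_mul_integral_trace_linkCutGlue_nonneg_of_mem_infiniteVolumeLimitPoints
    (hρ : Continuous ρ) (hτ : Continuous τ) {β : ℝ} (hβ : 0 ≤ β) {μ : Measure (LGConfig d G)}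
    (hμ : μ ∈ infiniteVolumeLimitPoints (d := d) ρ β) (i : Fin d) {p q : Fin d → ℤ}
    (hp : p i = 0) (hq : q i = 0) {n : ℕ} (O : Fin n → Word d)
    (hend : ∀ a, Word.endpointZd (p + Pi.single i 1) (O a) = q + Pi.single i 1)
    (hhalf : ∀ a, DependsOn (fun U : LGConfig d G => wordHolonomyZd U (p + Pi.single i 1) (O a))
      (linkHalfEdges i))
    (c : Fin n → ℂ) :
    0 ≤ ∑ a, ∑ b, conj (c a) * c b * ∫ U, (τ (wordHolonomyZd U p
      (Step.fwd i :: (O b ++ Step.bwd i :: Word.reverse ((O a).map (Step.flipAt i)))))).trace ∂μ := by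
  obtain ⟨φ, hφ, hprob, hconv⟩ := id hμ
  haveI := hprob
  exact sum_conj_mul_integral_trace_linkCutGlue_nonneg τ hτ
    (covariantLinkRP_of_mem_infiniteVolumeLimitPoints ρ hρ hβ hμ i) hp hq O hend hhalf c

/-- ★★★ **Cut-loop `R_link` blocks of torus limit points with loop-variable entries, decidable
hypotheses.** For `β ≥ 0`, continuous `ρ`, every infinite-volume torus limit point `μ`, every axis
`i`, sites `p, q` with `p_i = q_i = 0`, words `O_a : p + e_i → q + e_i` with
`Word.zdLinkHalfOK i (O a) (p + e_i)` and real `c`: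
`0 ≤ Σ_{ab} c_a c_b ∫ W_p([+e_i] · O_b · [-e_i] · (flip_i O_a)⁻¹) dμ` — Kazakov–Zheng's link-type
positivity matrices are exact constraints for these states. -/
theorem rLinkCutWordBlock_nonneg_of_mem_infiniteVolumeLimitPoints (hρ : Continuous ρ) {β : ℝ}
    (hβ : 0 ≤ β) {μ : Measure (LGConfig d G)} (hμ : μ ∈ infiniteVolumeLimitPoints (d := d) ρ β)
    (i : Fin d) {p q : Fin d → ℤ} (hp : p i = 0) (hq : q i = 0) {n : ℕ} (O : Fin n → Word d)
    (hend : ∀ a, Word.endpointZd (p + Pi.single i 1) (O a) = q + Pi.single i 1)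
    (hhalf : ∀ a, Word.zdLinkHalfOK i (O a) (p + Pi.single i 1) = true) (c : Fin n → ℝ) :
    0 ≤ ∑ a, ∑ b, c a * c b * ∫ U, wordLoopZd ρ p
      (Step.fwd i :: (O b ++ Step.bwd i :: Word.reverse ((O a).map (Step.flipAt i)))) U ∂μ := by
  obtain ⟨φ, hφ, hprob, hconv⟩ := id hμ
  haveI := hprob
  exact rLinkCutWordBlock_nonneg_of_zdLinkHalfOK ρ hρ
    (covariantLinkRP_of_mem_infiniteVolumeLimitPoints ρ hρ hβ hμ i) hp hq O hend hhalf c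

/-- ★ **The plaquette expectation of a torus limit point is non-negative, via link RP**
(`β ≥ 0`, continuous `ρ`, every dimension): `0 ≤ ∫ W_p(P_{ik}) dμ` at every site `p` of the
layer `x_i = 0`, `k ≠ i` — the `1 × 1` cut-loop block. -/
theorem integral_wordLoopZd_plaquette_nonneg_of_mem_infiniteVolumeLimitPoints (hρ : Continuous ρ)
    {β : ℝ} (hβ : 0 ≤ β) {μ : Measure (LGConfig d G)}
    (hμ : μ ∈ infiniteVolumeLimitPoints (d := d) ρ β) {i : Fin d} {p : Fin d → ℤ} (hp : p i = 0)
    {k : Fin d} (hk : k ≠ i) :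
    0 ≤ ∫ U, wordLoopZd ρ p (Word.plaquette i k) U ∂μ := by
  obtain ⟨φ, hφ, hprob, hconv⟩ := id hμ
  haveI := hprob
  exact integral_wordLoopZd_plaquette_nonneg_of_isCovariantLinkRP ρ hρ
    (covariantLinkRP_of_mem_infiniteVolumeLimitPoints ρ hρ hβ hμ i) hp hk

end LimitPoints


end

end Summit.QuantumFields.GaugeBoot
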